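import Mathlib
import Summits.ResolutionOfSingularities.ResolutionOfSingularities.Theorems.RadicialJungCleanModelsCleanProp44ChartSigmaStep
import HarnessLib

/-!
# Route `RadicialJung`, crux `CleanModels` (stmt-ResolutionOfSingularities-15917), line `Sketch` rev 35, stub 6 `stub_cleanProp44` (X44c):
# THE σ-TOWER (census (S1)), REGULARITY CLIMBS A STOREY — the pair `(t′, v′)` = (chart fraction, exceptional parameter) upstairs is part of a regular
# system of parameters of `𝒪_{X′,x′}`, and the σ-storey for a PRESCRIBED `t′`

Seat decomp-res-hand-2 g23 (structural hand); sequel of ✓ `…ChartStalk` / ✓ `…ChartSigmaStep` / ✓ `…ChartPointStep` (hand-2 g22).  The storeys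
✓ `exists_sigmaStep_of_isBlowup` (levels `≥ 1`) and ✓ `exists_pointStep_of_isBlowup` (level `0`) of the σ-tower of memo 4e §2.5 consume, at their own
level, a regular system of parameters `(c, w)` of `𝒪_{X,x}` (`hR`, `hz`, `hdim`) — but do not return one upstairs, so they cannot yet be CHAINED along the
ℕ-indexed tower (census (S1), the residual of (S2) named by the g22 memo).  This file supplies the missing output, in stalk language and for ANY chart
relations (so that it applies to the witnesses of both storeys):

* `isRsopPart_pair_of_isBlowup` — for a blowing up `τ : X′ → X` along `J` (`IsBlowup τ J`), `x′` over `x = τ x′`, `(c, w)` a regular system of parameters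
  of `𝒪_{X,x}` with `(c) = J_x`, and ANY chart relations `τ♯c_k = τ♯cᵢ · uf_k` with a charged fraction `uf_{k₀} ∈ 𝔪_{x′}`: the pair `(uf_{k₀}, τ♯cᵢ)` is
  PART OF A REGULAR SYSTEM OF PARAMETERS of `𝒪_{X′,x′}` (tree: ✓ `isRsopPart_chartFamily_reesChart` on the Rees chart of ✓ `IsBlowup.exists_reesChart_stalk`;
  two chart presentations at the same point differ by units: `uf_{i′}·uf′ᵢ = 1`).  In particular `𝒪_{X′,x′}` is regular and `(uf_{k₀}, τ♯cᵢ)` extends to a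
  regular system of parameters `(c′, w′)` with `dim 𝒪_{X′,x′} = 2 + l′` (`IsRsopPart.exists_append_eq_maximalIdeal`) — EXACTLY the input `hR, hz, hdim` of
  the next storey.
* `sigmaStep_of_isBlowup_of_eq` — the σ-storey ✓ `exists_sigmaStep_of_isBlowup` for a PRESCRIBED fraction `t′` with `τ♯t = τ♯v · t′` (the fraction is
  unique, `τ♯v` being a non-zero-divisor): all seven conjuncts of the storey hold for this `t′`, plus `IsRsopPart ![t′, τ♯v]` — the form the chaining
  induction consumes (the user's `t_{j+1}` transported down the stalk identification).

Honest framing: OURS, instantiation/bookkeeping only (Stacks 0804/0BIQ + Matsumura 14.2 as typed in the tree); nothing here proves X44c, any case of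
`CleanModels`, or resolution of singularities in characteristic `p`. [cite: StacksProject, Tag 0804, Tag 0BIQ] [cite: Matsumura1987, Thm. 14.2]
[cite: CossartPiltant2008, Prop. 4.4 (proof, p. 11)]
-/

noncomputable section

set_option linter.dupNamespace false -- mandated namespace of this single-conjunct summit

open IsLocalRing CategoryTheory AlgebraicGeometry
open Literature.AlgebraicGeometry.Resolution

namespace Summit.ResolutionOfSingularities.ResolutionOfSingularities.Theorems.RadicialJung.CleanModels

universe u

/-! ## §0 Small bookkeeping on pairs and parts of regular systems of parameters -/

section Pairs

variable {R : Type u}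

/-- The range of an appended family is the union of the ranges. [folklore] -/
theorem range_fin_append {n m : ℕ} (f : Fin n → R) (g : Fin m → R) :
    Set.range (Fin.append f g) = Set.range f ∪ Set.range g := by
  ext a
  constructor
  · rintro ⟨i, rfl⟩
    induction i using Fin.addCases with
    | left j => exact Or.inl ⟨j, by simp⟩
    | right k => exact Or.inr ⟨k, by simp⟩
  · rintro (⟨j, rfl⟩ | ⟨k, rfl⟩)
    · exact ⟨Fin.castAdd m j, by simp⟩
    · exact ⟨Fin.natAdd n k, by simp⟩

variable [CommRing R] [IsLocalRing R]

/-- **A part of a regular system of parameters extends to one in the storeys' format**: `IsRsopPart c` gives `w : Fin l → R` with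
`Ideal.span (range (Fin.append c w)) = 𝔪` and `dim R = n + l` (and `R` regular). [cite: Matsumura1987, Thm. 14.2] -/
theorem IsRsopPart.exists_append_eq_maximalIdeal {n : ℕ} {c : Fin n → R} (hc : IsRsopPart c) :
    IsRegularLocalRing R ∧ ∃ (l : ℕ) (w : Fin l → R), Ideal.span (Set.range (Fin.append c w)) = maximalIdeal R ∧
      ringKrullDim R = ((n + l : ℕ) : WithBot ℕ∞) := by
  obtain ⟨hR, l, w, hdim, hspan⟩ := hc
  exact ⟨hR, l, w, by rwa [range_fin_append], hdim⟩

end Pairs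

/-! ## §1 Two chart presentations at one point differ by units; the pair `(uf_{k₀}, τ♯cᵢ)` is part of a regular system of parameters -/

section Rsop

variable {X X' : Scheme.{u}} {τ : X' ⟶ X} {J : X.IdealSheafData}

/-- Two systems of chart relations at the same point, `τ♯c_k = τ♯cᵢ·uf_k` and `τ♯c_k = τ♯c_{i′}·uf′_k` with `uf′_{i′} = 1` and `τ♯cᵢ` a non-zero-divisor,
have `uf_{i′} · uf′ᵢ = 1`. [folklore] -/
theorem uf_mul_uf_eq_one (x' : X') {n : ℕ} (c : Fin n → X.presheaf.stalk (τ x')) (i i' : Fin n)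
    (uf uf' : Fin n → X'.presheaf.stalk x')
    (hrel : ∀ k, (τ.stalkMap x').hom (c k) = (τ.stalkMap x').hom (c i) * uf k)
    (hrel' : ∀ k, (τ.stalkMap x').hom (c k) = (τ.stalkMap x').hom (c i') * uf' k)
    (hnzd : (τ.stalkMap x').hom (c i) ∈ nonZeroDivisors (X'.presheaf.stalk x')) :
    uf i' * uf' i = 1 := by
  have h1 : (τ.stalkMap x').hom (c i) * (uf i' * uf' i) = (τ.stalkMap x').hom (c i) * 1 := by
    rw [mul_one, ← mul_assoc, ← hrel i', ← hrel' i]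
  exact (mul_cancel_left_mem_nonZeroDivisors hnzd).mp h1

/-- Under the same two systems of relations, `uf′_k = uf′ᵢ · uf_k` for every `k`. [folklore] -/
theorem uf'_eq_mul (x' : X') {n : ℕ} (c : Fin n → X.presheaf.stalk (τ x')) (i i' : Fin n)
    (uf uf' : Fin n → X'.presheaf.stalk x')
    (hrel : ∀ k, (τ.stalkMap x').hom (c k) = (τ.stalkMap x').hom (c i) * uf k)
    (hrel' : ∀ k, (τ.stalkMap x').hom (c k) = (τ.stalkMap x').hom (c i') * uf' k)
    (hnzd : (τ.stalkMap x').hom (c i) ∈ nonZeroDivisors (X'.presheaf.stalk x')) (k : Fin n) :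
    uf' k = uf' i * uf k := by
  have hone := uf_mul_uf_eq_one x' c i i' uf uf' hrel hrel' hnzd
  -- `τ♯cᵢ uf_k = τ♯c_{i'} uf'_k = τ♯cᵢ uf_{i'} uf'_k`
  have h1 : (τ.stalkMap x').hom (c i) * uf k = (τ.stalkMap x').hom (c i) * (uf i' * uf' k) := by
    rw [← hrel k, hrel' k, hrel i', mul_assoc]
  have h2 : uf k = uf i' * uf' k := (mul_cancel_left_mem_nonZeroDivisors hnzd).mp h1
  calc uf' k = (uf i' * uf' i) * uf' k := by rw [hone, one_mul]
    _ = uf' i * (uf i' * uf' k) := by ring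
    _ = uf' i * uf k := by rw [← h2]

set_option maxHeartbeats 400000 in
/-- **The pair `(uf_{k₀}, τ♯cᵢ)` is part of a regular system of parameters of `𝒪_{X′,x′}`** (see the module docstring).  Here `(c, w)` is a regular
system of parameters of the regular local ring `𝒪_{X,x}` (`x = τ x′`), `(c) = J_x`, `τ♯c_k = τ♯cᵢ·uf_k` are ANY chart relations and `uf_{k₀} ∈ 𝔪_{x′}`
(the point lies on the strict transform of `V(c_{k₀})`). [cite: StacksProject, Tag 0804, Tag 0BIQ] [cite: Matsumura1987, Thm. 14.2] -/
theorem isRsopPart_pair_of_isBlowup (hτ : IsBlowup τ J) (x' : X') (hR : IsRegularLocalRing (X.presheaf.stalk (τ x')))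
    {n l : ℕ} (c : Fin n → X.presheaf.stalk (τ x')) (w : Fin l → X.presheaf.stalk (τ x'))
    (hz : Ideal.span (Set.range (Fin.append c w)) = maximalIdeal (X.presheaf.stalk (τ x')))
    (hdim : ringKrullDim (X.presheaf.stalk (τ x')) = ((n + l : ℕ) : WithBot ℕ∞))
    (hcJ : Ideal.span (Set.range c) = stalkIdeal J (τ x')) (i : Fin n) (uf : Fin n → X'.presheaf.stalk x')
    (hrel : ∀ k, (τ.stalkMap x').hom (c k) = (τ.stalkMap x').hom (c i) * uf k) (k₀ : Fin n)
    (hk₀ : uf k₀ ∈ maximalIdeal (X'.presheaf.stalk x')) :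
    IsRsopPart ![uf k₀, (τ.stalkMap x').hom (c i)] := by
  haveI := hR
  have hd : (maximalIdeal (X.presheaf.stalk (τ x'))).spanFinrank = n + l := by
    have h1 := IsRegularLocalRing.spanFinrank_maximalIdeal (R := X.presheaf.stalk (τ x'))
    rw [hdim] at h1
    exact_mod_cast h1
  have hnzd := stalkMap_mem_nonZeroDivisors_of_isBlowup hτ x' c hcJ i uf hrel
  obtain ⟨i', 𝔴, χ, hχ, hloc, hcomap⟩ := hτ.exists_reesChart_stalk x' c hcJ
  letI := χ.toAlgebra
  haveI := hloc
  have halg : ∀ z, algebraMap (chartRing c i') (X'.presheaf.stalk x') z = χ z := fun z => by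
    rw [RingHom.algebraMap_toAlgebra]
  -- the second system of relations
  have hnzd' := reesChartBase_mem_nonZeroDivisors (c i') (Ideal.mem_span_range_self (f := c) (x := i'))
  have hrelB : ∀ k, chartBase c i' (c k) = chartBase c i' (c i') * chartGen c i' k := reesChartBase_apply_eq_mul_chartGen c i'
  have hrel' : ∀ k, (τ.stalkMap x').hom (c k) = (τ.stalkMap x').hom (c i') * χ (chartGen c i' k) := fun k => by
    rw [← hχ, ← hχ, ← map_mul, hrelB k]
  have huf'i' : χ (chartGen c i' i') = 1 := by
    rw [centreChartFrac_self c i' (chartBase c i') (chartGen c i') hrelB hnzd', map_one]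
  -- `uf′_{k₀} = uf′ᵢ · uf_{k₀} ∈ 𝔪′`, and `uf′ᵢ` is a unit
  have hone := uf_mul_uf_eq_one x' c i i' uf (fun k => χ (chartGen c i' k)) hrel hrel' hnzd
  have hk₀' : χ (chartGen c i' k₀) ∈ maximalIdeal (X'.presheaf.stalk x') := by
    rw [uf'_eq_mul x' c i i' uf (fun k => χ (chartGen c i' k)) hrel hrel' hnzd k₀]
    exact Ideal.mul_mem_left _ _ hk₀
  have hk₀i' : k₀ ≠ i' := by
    rintro rfl
    rw [huf'i'] at hk₀'
    exact (IsLocalRing.maximalIdeal.isMaximal _).ne_top (Ideal.eq_top_of_isUnit_mem _ hk₀' isUnit_one)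
  have hmem : chartGen c i' k₀ ∈ 𝔴.asIdeal :=
    (IsLocalization.AtPrime.to_map_mem_maximal_iff (X'.presheaf.stalk x') 𝔴.asIdeal _).mp (by rw [halg]; exact hk₀')
  -- the tree's theorem: `(τ♯c_{i'}, uf′_{k₀}, τ♯w)` is part of a regular system of parameters
  have hpart := isRsopPart_chartFamily_reesChart c i' w hz hd 𝔴.asIdeal hcomap (X'.presheaf.stalk x')
    (fun _ : Fin 1 => (⟨k₀, hk₀i'⟩ : {j : Fin n // j ≠ i'})) (fun a b _ => Subsingleton.elim a b) (fun _ => hmem)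
  -- extract the pair `(uf′_{k₀}, τ♯c_{i'})`
  have hpair : IsRsopPart ![χ (chartGen c i' k₀), (τ.stalkMap x').hom (c i')] := by
    have h2 := hpart.comp ![Fin.succ (Fin.castAdd l (0 : Fin 1)), 0] (by
      intro a b hab
      fin_cases a <;> fin_cases b
      · rfl
      · exact absurd hab (by simp [Fin.succ_ne_zero])
      · exact absurd hab.symm (by simp [Fin.succ_ne_zero])
      · rfl)
    have heq : chartFamily c i' w (X'.presheaf.stalk x') (chartBase c i') (chartGen c i') (fun _ : Fin 1 => (⟨k₀, hk₀i'⟩ : {j : Fin n // j ≠ i'})) ∘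
        ![Fin.succ (Fin.castAdd l (0 : Fin 1)), 0] = ![χ (chartGen c i' k₀), (τ.stalkMap x').hom (c i')] := by
      funext a
      fin_cases a
      · simp [chartFamily, halg, Fin.append_left]
      · simp [chartFamily, halg, hχ]
    rwa [heq] at h2
  -- pass to the associated pair `(uf_{k₀}, τ♯cᵢ)`
  refine hpair.of_associated fun a => ?_
  fin_cases a
  · -- `uf′_{k₀} = uf′ᵢ uf_{k₀}` with `uf′ᵢ` a unit
    change Associated (χ (chartGen c i' k₀)) (uf k₀)
    have hu : IsUnit (χ (chartGen c i' i)) := IsUnit.of_mul_eq_one_right _ hone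
    rw [uf'_eq_mul x' c i i' uf (fun k => χ (chartGen c i' k)) hrel hrel' hnzd k₀]
    exact (associated_unit_mul_left (uf k₀) _ hu)
  · -- `τ♯c_{i'} = τ♯cᵢ · uf_{i'}` with `uf_{i'}` a unit
    change Associated ((τ.stalkMap x').hom (c i')) ((τ.stalkMap x').hom (c i))
    have hu : IsUnit (uf i') := IsUnit.of_mul_eq_one _ hone
    rw [hrel i']
    exact (associated_mul_unit_left ((τ.stalkMap x').hom (c i)) _ hu)

end Rsop

/-! ## §2 The σ-storey for a prescribed fraction `t′` -/

section SigmaStepEq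

variable {X X' : Scheme.{u}} {τ : X' ⟶ X} {J : X.IdealSheafData}

set_option maxHeartbeats 400000 in
-- the statement is long; elaboration of the eight conjuncts
/-- **THE σ-STOREY FOR A PRESCRIBED `t′`**: under the hypotheses of ✓ `exists_sigmaStep_of_isBlowup` and for ANY `t′` with `τ♯t = τ♯v · t′`, all conjuncts
of the storey hold for this `t′` (the fraction is unique: `τ♯v` is a non-zero-divisor), and moreover `(t′, τ♯v)` is part of a regular system of parameters of
`𝒪_{X′,x′}` — the inputs `hR, hz, hdim` of the NEXT storey (`IsRsopPart.exists_append_eq_maximalIdeal`). [cite: StacksProject, Tag 0804, Tag 0BIQ]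
[cite: Matsumura1987, Thm. 14.2] [cite: CossartPiltant2008, Prop. 4.4 (proof, p. 11)] -/
theorem sigmaStep_of_isBlowup_of_eq (hτ : IsBlowup τ J) (x' : X') (hR : IsRegularLocalRing (X.presheaf.stalk (τ x'))) {l : ℕ}
    (c : Fin 2 → X.presheaf.stalk (τ x')) (w : Fin l → X.presheaf.stalk (τ x'))
    (hz : Ideal.span (Set.range (Fin.append c w)) = maximalIdeal (X.presheaf.stalk (τ x')))
    (hdim : ringKrullDim (X.presheaf.stalk (τ x')) = ((2 + l : ℕ) : WithBot ℕ∞))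
    (hcJ : Ideal.span (Set.range c) = stalkIdeal J (τ x'))
    (hL : (τ.stalkMap x').hom (c 0) ∈ (stalkIdeal J (τ x')).map (τ.stalkMap x').hom * maximalIdeal (X'.presheaf.stalk x'))
    (hJ0 : (stalkIdeal J (τ x')).map (τ.stalkMap x').hom ≠ ⊥)
    (t' : X'.presheaf.stalk x') (ht' : (τ.stalkMap x').hom (c 0) = (τ.stalkMap x').hom (c 1) * t') :
    t' ∈ maximalIdeal (X'.presheaf.stalk x') ∧
      (τ.stalkMap x').hom (c 1) ∈ nonZeroDivisors (X'.presheaf.stalk x') ∧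
      IsRsopPart ![t', (τ.stalkMap x').hom (c 1)] ∧
      IsLocalRing (X'.presheaf.stalk x' ⧸ Ideal.span {(τ.stalkMap x').hom (c 1)}) ∧
      IsLocalRing (X'.presheaf.stalk x' ⧸ Ideal.span {(τ.stalkMap x').hom (c 1), t'}) ∧
      ((∀ q : X'.presheaf.stalk x' ⧸ Ideal.span {(τ.stalkMap x').hom (c 1), t'},
          ∃ r, Ideal.Quotient.mk _ ((τ.stalkMap x').hom r) = q) ∧
        (∀ r, (τ.stalkMap x').hom r ∈ Ideal.span {(τ.stalkMap x').hom (c 1), t'} → r ∈ Ideal.span (Set.range c)) ∧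
        (∀ (K : Type u) [CommRing K] [Algebra K (X.presheaf.stalk (τ x') ⧸ Ideal.span (Set.range c))] (M₀ : Submonoid K)
          [IsLocalization M₀ (X.presheaf.stalk (τ x') ⧸ Ideal.span (Set.range c))]
          (inst : Algebra K (X'.presheaf.stalk x' ⧸ Ideal.span {(τ.stalkMap x').hom (c 1), t'})),
          (∀ (g : K) (r : X.presheaf.stalk (τ x')), Ideal.Quotient.mk _ r = algebraMap K (X.presheaf.stalk (τ x') ⧸ Ideal.span (Set.range c)) g →
            algebraMap K (X'.presheaf.stalk x' ⧸ Ideal.span {(τ.stalkMap x').hom (c 1), t'}) g = Ideal.Quotient.mk _ ((τ.stalkMap x').hom r)) →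
          IsLocalization M₀ (X'.presheaf.stalk x' ⧸ Ideal.span {(τ.stalkMap x').hom (c 1), t'}))) ∧
      (∀ (K : Type u) [CommRing K] [Algebra K (X.presheaf.stalk (τ x') ⧸ Ideal.span (Set.range c))] (M₀ : Submonoid K)
        [IsLocalization M₀ (X.presheaf.stalk (τ x') ⧸ Ideal.span (Set.range c))]
        (inst : Algebra (Polynomial K) (X'.presheaf.stalk x' ⧸ Ideal.span {(τ.stalkMap x').hom (c 1)})),
        (∀ (g : K) (r : X.presheaf.stalk (τ x')), Ideal.Quotient.mk _ r = algebraMap K (X.presheaf.stalk (τ x') ⧸ Ideal.span (Set.range c)) g →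
          algebraMap (Polynomial K) (X'.presheaf.stalk x' ⧸ Ideal.span {(τ.stalkMap x').hom (c 1)}) (Polynomial.C g) =
            Ideal.Quotient.mk _ ((τ.stalkMap x').hom r)) →
        algebraMap (Polynomial K) (X'.presheaf.stalk x' ⧸ Ideal.span {(τ.stalkMap x').hom (c 1)}) Polynomial.X = Ideal.Quotient.mk _ t' →
        ∃ N : Submonoid (Polynomial K), IsLocalization N (X'.presheaf.stalk x' ⧸ Ideal.span {(τ.stalkMap x').hom (c 1)})) := by
  obtain ⟨t'', ht'', ht''𝔪, hnzd, hlocE, hlocZ, hZ, hE⟩ := exists_sigmaStep_of_isBlowup hτ x' hR c w hz hdim hcJ hL hJ0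
  -- the fraction is unique
  obtain rfl : t'' = t' := (mul_cancel_left_mem_nonZeroDivisors hnzd).mp (by rw [← ht'', ← ht'])
  refine ⟨ht''𝔪, hnzd, ?_, hlocE, hlocZ, hZ, hE⟩
  -- the relations `τ♯c_k = τ♯c_1 · uf_k` with `uf = (t′, 1)`
  have hrel : ∀ k, (τ.stalkMap x').hom (c k) = (τ.stalkMap x').hom (c 1) * (![t'', 1] : Fin 2 → X'.presheaf.stalk x') k := by
    intro k
    rcases Fin.exists_fin_two.mp ⟨k, rfl⟩ with h | h <;> rw [h]
    · exact ht''
    · simp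
  exact isRsopPart_pair_of_isBlowup hτ x' hR c w hz hdim hcJ 1 ![t'', 1] hrel 0 ht''𝔪

end SigmaStepEq

end Summit.ResolutionOfSingularities.ResolutionOfSingularities.Theorems.RadicialJung.CleanModels

end
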